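import Summits.AtomisticToContinuum.BoseEinsteinCondensation.Theses.BECCellInformation
import Summits.AtomisticToContinuum.BoseEinsteinCondensation.Theorems.BECCellInformationOneBodyEntropyBound
import Summits.AtomisticToContinuum.BoseEinsteinCondensation.Theorems.BECCellInformationCoarseChainRule
import Summits.AtomisticToContinuum.BoseEinsteinCondensation.Theorems.BECCellInformationEnergyPerParticleBound
import Summits.AtomisticToContinuum.BoseEinsteinCondensation.Theorems.BECCellInformationTwoScaleReduction
import Summits.AtomisticToContinuum.BoseEinsteinCondensation.Theorems.BECCellInformationEntropicZeroMode
import Summits.AtomisticToContinuum.BoseEinsteinCondensation.Theorems.BECCellInformationNonnegNearMinimiser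
import Summits.AtomisticToContinuum.BoseEinsteinCondensation.Theorems.BECCellInformationZeroModeTransfer
import Summits.AtomisticToContinuum.BoseEinsteinCondensation.Theorems.BECCellInformationCellInformationBoundOfCondEntropy

/-!
# Crux `CellInformationBound` (stmt-AtomisticToContinuum-13439): its exact position in route `BECCellInformation`

Pure compositions of theorems ALREADY LANDED in the tree (no new mathematics), recorded as named,
citeable facts for the planners / strategist of route `route-AtomisticToContinuum-BECCellInformation`
(10 of 12 items closed; open: the crux `CellInformationBound` = stmt-13439, the target
`CondEntropyBound` = stmt-13438, and `GroundStateRigidity` = stmt-9072):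

* `condEntropyBound_of_cellInformationBound` — **crux ⇒ target**:
  `CellInformationBound → CondEntropyBound`, by `TwoScaleReduction` (p: `twoScaleReduction_proof`)
  applied to `EnergyPerParticleBound` (`energyPerParticleBound_proof`) and to the coarse conditional
  entropy bound produced by `CoarseChainRule` (`coarseChainRule_proof`) from the crux and the landed
  crux 3 `OneBodyEntropyBound` (`oneBodyEntropyBound_proof`).
* `cellInformationBound_iff_condEntropyBound` — with the converse glue
  `cellInformationBound_of_condEntropyBound` (lead c3, p163703): **crux ⇔ target** — the route has
  exactly ONE open mathematical statement up to logical equivalence in the tree, besides 9072.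
* `zeroModeBound_of_cellInformationBound` — **crux ⇒ macroscopic zero-mode occupation for every
  non-negative near-minimiser** (`⟨φ₀, γ_Ψ φ₀⟩ ≥ cN`, `φ₀ = L^{-3/2}·1_Λ`), UNCONDITIONALLY (no
  `GroundStateRigidity`): `EntropicZeroMode` (`entropicZeroMode_proof`, Rényi-½/Jensen) after the
  first item.  This is the positive-sector content of BEC and is why the crux is "BEC-hard".
* `boseEinsteinCondensation_of_cellInformationBound` — **crux ∧ GroundStateRigidity ⇒ the conjunct
  `BoseEinsteinCondensation`**: the route's deciding theorem `closes` with its eight landed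
  hypotheses discharged (`OccupationStability_holds`, `nonnegNearMinimiser_proof`,
  `zeroModeTransfer_proof`, …).

[folklore] (bookkeeping over the route file; every ingredient is a kernel-checked theorem of the tree).
-/

namespace Summit.AtomisticToContinuum.BoseEinsteinCondensation.Theorems.CellInformationBound

open Summit.AtomisticToContinuum.BoseEinsteinCondensation.Theses.BECCellInformation

/-- **Crux ⇒ target.** `CellInformationBound → CondEntropyBound`: the N-uniform coarse mutual
information bound (crux 2, stmt-13439) implies the bounded conditional entropy deficit (target,
stmt-13438), because the other inputs of the two-scale reduction are theorems of the tree: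
`OneBodyEntropyBound` (crux 3, landed), `CoarseChainRule`, `EnergyPerParticleBound`,
`TwoScaleReduction` (all landed).  Literally `hT hE (hCR hA hB)` of the route's `closes`.
[folklore] -/
theorem condEntropyBound_of_cellInformationBound : Summit.AtomisticToContinuum.BoseEinsteinCondensation.Theses.BECCellInformation.CellInformationBound → Summit.AtomisticToContinuum.BoseEinsteinCondensation.Theses.BECCellInformation.CondEntropyBound :=
  fun hA => TwoScaleReduction.twoScaleReduction_proof energyPerParticleBound_proof
    (coarseChainRule_proof hA oneBodyEntropyBound_proof)

/-- **Crux ⇔ target** in the tree: `CellInformationBound ↔ CondEntropyBound` (stmt-13439 ⇔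
stmt-13438), from `condEntropyBound_of_cellInformationBound` and lead c3's converse
`cellInformationBound_of_condEntropyBound` (data processing + Gibbs, every trial state, `l = 1`).
[folklore] -/
theorem cellInformationBound_iff_condEntropyBound : CellInformationBound ↔ CondEntropyBound :=
  ⟨condEntropyBound_of_cellInformationBound, cellInformationBound_of_condEntropyBound⟩

/-- **Crux ⇒ positive-sector BEC, unconditionally.** From `CellInformationBound` alone (no
`GroundStateRigidity`): for every repulsive finite-range `v` there is `ρ₀ > 0` such that for
`0 < ρ < ρ₀` there is `c > 0` with, for all large `N`, some `δ > 0` such that every NON-NEGATIVE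
`δ`-near-minimiser `Ψ` has zero-mode occupation `⟨φ₀, γ_Ψ φ₀⟩ ≥ c N`
(`φ₀ = (√(L³))⁻¹ · 1_{Λ_L}`, `L = (N/ρ)^{1/3}`) — the conclusion of the landed `EntropicZeroMode`
(Rényi-½ identity + Jensen) applied to `condEntropyBound_of_cellInformationBound`.  [folklore] -/
theorem zeroModeBound_of_cellInformationBound (hA : CellInformationBound) :
    ∀ v : ℝ → ENNReal, Literature.MathematicalPhysics.QuantumManyBody.BoseGas.IsRepulsiveFiniteRange v →
      ∃ ρ₀ : ℝ, 0 < ρ₀ ∧ ∀ ρ : ℝ, 0 < ρ → ρ < ρ₀ → ∃ c : ℝ, 0 < c ∧ ∀ᶠ N : ℕ in Filter.atTop,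
        ∃ δ : ENNReal, 0 < δ ∧
          ∀ Ψ : Literature.MathematicalPhysics.QuantumManyBody.BoseGas.TrialState N
              (Literature.MathematicalPhysics.QuantumManyBody.BoseGas.sideLength ρ N),
            Literature.MathematicalPhysics.QuantumManyBody.BoseGas.energy v Ψ ≤
                Literature.MathematicalPhysics.QuantumManyBody.BoseGas.groundStateEnergy v N
                  (Literature.MathematicalPhysics.QuantumManyBody.BoseGas.sideLength ρ N) + δ →
              (∀ X, Ψ.ψ X = (‖Ψ.ψ X‖ : ℂ)) →
                ENNReal.ofReal (c * N) ≤
                  Literature.MathematicalPhysics.QuantumManyBody.BoseGas.occupation N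
                    ((Literature.MathematicalPhysics.QuantumManyBody.BoseGas.box
                        (Literature.MathematicalPhysics.QuantumManyBody.BoseGas.sideLength ρ N)).indicator
                      fun _ => ((Real.sqrt
                        (Literature.MathematicalPhysics.QuantumManyBody.BoseGas.sideLength ρ N ^ 3))⁻¹ : ℂ))
                    Ψ.ψ :=
  entropicZeroMode_proof (condEntropyBound_of_cellInformationBound hA)

/-- **Crux ∧ rigidity ⇒ the conjunct.** `CellInformationBound → GroundStateRigidity →
BoseEinsteinCondensation`: the route's deciding theorem `closes` with its eight landed hypotheses
discharged by the tree's theorems (`oneBodyEntropyBound_proof`, `coarseChainRule_proof`,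
`energyPerParticleBound_proof`, `twoScaleReduction_proof`, `entropicZeroMode_proof`,
`nonnegNearMinimiser_proof`, `OccupationStability_holds`, `zeroModeTransfer_proof`).  So the two
open items stmt-13439 (⇔ stmt-13438) and stmt-9072 are exactly what separates the tree from the
conjunct along this route.  [folklore] -/
theorem boseEinsteinCondensation_of_cellInformationBound :
    CellInformationBound → GroundStateRigidity → _root_.BoseEinsteinCondensation :=
  fun hA hR => closes hA oneBodyEntropyBound_proof hR coarseChainRule_proof energyPerParticleBound_proof
    TwoScaleReduction.twoScaleReduction_proof entropicZeroMode_proof nonnegNearMinimiser_proof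
    OccupationStability_holds zeroModeTransfer_proof

end Summit.AtomisticToContinuum.BoseEinsteinCondensation.Theorems.CellInformationBound
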